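import Literature.MathematicalPhysics.QuantumFieldTheory.Balaban1983to89.B4Ineq46Lattice

/-!
# `Balaban1983to89.B4Ineq44MassPart` — [Balaban1983RegularityDecay] p. 589, (4.1)–(4.4): THE MASS PART OF THE LOWER
# BOUND FOR `Δ^{(k)}(Ω,A)` AS PRINTED, `⟨φ, Δ^{(k)}(Ω,A)φ⟩ ≥ Σ_{x∈Ω^{(k)}} (a_km²/(a_k + m²))|φ(x)|²`, FOR EVERY LINK FIELD

statement-level skeleton of published theorems with citation tags; proofs where landed; nothing here is a claim about the Yang–Mills mass gap

CITATION HEADER.  T. Bałaban, *Regularity and decay of lattice Green's functions*, Commun. Math. Phys. **89** (1983)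
571–597, doi:10.1007/bf01214744 [Balaban1983RegularityDecay] (cell paper B4; held text
`paper:balaban1983-cmp89-regularity-decay`, journal page = PDF page + 570; p. 589 [PDF 19] L11–L27 read on the text layer
and on the ×2 render `run/shared/lean/pub/pub-balaban/b2b-balaban-ref1/pages/1983-cmp89-regularity-decay/…-p019-x2.png`).
Unit `lit-balaban-r04` gen 11 (second reader of block B4; HOME `run/shared/lean/pub/lit-balaban/`), SKELETON row
**B4.Eq4.4** ((4.1)–(4.4), owner r01; head «proved-existing (A = 0) / bookkeeping»: `B4Prop31Zero` at `A = 0`,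
`B4.prop31_gamma0`).  In the tree for a general link field only p35's weakened form `B4Prop31Energy.mass_le`
(`m²|ψ|² ≤ 2m²|ψ − sQΦ|² + 2m²s|Φ|²`, parallelogram bound; its docstring: «the print's exact single-block value is
a_km²/(a_k + m²)») was available; this file proves the display with the EXACT printed constant.  Imports: r04's
`B4Ineq46Lattice` ((4.6) as printed and the reduction «sufficient to prove (4.7)»; hence r01's `B4Ineq45Decoupling`
(`covLap_form_nonneg`/`kinMass_form`), p35's `B4Prop31Energy` (`keff` = `Δ^{(k)}(Ω,A)` of (1.14), the exponent `cenergy`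
of (4.2), its critical point `gStar` and `cenergy_gStar` = (4.1)–(4.3), Jensen on blocks `sum_avg_sq_le`, `resid_sq_eq`)
and p35's `B4Eq16GreenExists` (`b4Op_posDef`: (1.6) is positive definite for every `A`)).

WHAT IS PRINTED (p. 589 [PDF 19], from the render; the text layer L11–L27 is OCR-damaged at the displays).  «We will
estimate the quadratic form on the left hand side of (1.18) in several ways, finally getting all the terms on the right
hand side. At first we have G_k(Ω,A) ≤ ((a_kP_k(A) + m²)|_Ω)^{−1} and the left side of (1.18) can be estimated from below
by Σ_{x∈Ω^{(k)}} [a_k|φ(x)|² − a_k²⟨φ, (Q_k(A)((a_kP_k(A) + m²)|_{B^k(x)})^{−1}Q_k^*(A))(x,x)φ(x)⟩]. (4.1)  Each term of the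
above sum is determined by the integral ∫dφ′|_{B^k(x)} exp[−½a_k|φ(x) − (Q_k(A)φ′)(x)|² − ½m² Σ_{x′∈B^k(x)} η^d|φ′(x′)|²]
(4.2) … Then we get … = const′ exp[−½ (a_km²/(a_k + m²))|φ(x)|²], (4.3) and hence (the left hand side of (1.18)) ≥
Σ_{x∈Ω^{(k)}} (a_km²/(a_k + m²))|φ(x)|² ≥ (a_k/(a_k + O(1))) m² Σ_{x∈Ω^{(k)}} |φ(x)|² (4.4) if m² ≤ O(1). Thus a part of the
inequality (1.18) is proved.»  («the left hand side of (1.18)» = `⟨φ, Δ^{(k)}(Ω,A)φ⟩` of (1.22), by the paper's global +4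
cross-reference shift, CENSUS-r01.)

WHAT THIS MODULE PROVES (all in full; p35's lattice-unit dictionary: `Δ^{(k)} = keff c m2 a s q W T = a·1 − a²s·QGQᵀ`,
`s` = the block normalisation `η^{d+1} = n^{−(d+1)}` so that `s·Q` is the block AVERAGE, `q` the block weights with row
sums `≤ N`, `sN ≤ 1`, column sums `≤ 1`, `T` the transporters, orthogonal where `q ≠ 0` — every link field `W`).
* §1 `mass_pointwise` — the single-block minimum behind (4.3): `m²|v|² + a|w − v|² ≥ (am²/(a + m²))|w|²` (exact:
  `(a+m²)(m²|v|² + a|w−v|²) − am²|w|² = |m²v − a(w−v)|²`).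
* §2 **`ineq44_printed`** — (4.4) AS PRINTED for every link field: `(a·m²/(a + m²))·|ψ|² ≤ ⟨ψ, Δ^{(k)}ψ⟩`, i.e.
  `⟨φ, Δ^{(k)}(Ω,A)φ⟩ ≥ Σ_{x∈Ω^{(k)}} (a_km²/(a_k+m²))|φ(x)|²` (`|ψ|² = Σ_x|ψ(x)|²`, `dotProduct_eq_sum_fld`).  Proof as
  printed: (4.1)–(4.3) = the variational identity `⟨ψ,Δ^{(k)}ψ⟩ = s⟨Φ⋆,(−Δ_W + m²)Φ⋆⟩ + a|ψ − sQΦ⋆|²` (`cenergy_gStar`),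
  «G_k(Ω,A) ≤ ((a_kP_k(A)+m²)|_Ω)^{−1}» = dropping the kinetic term `−Δ_W ≥ 0`, Jensen on the blocks
  (`Σ_x|sQΦ(x)|² ≤ s|Φ|²`, p35) and the single-block minimum §1 summed over `x ∈ Ω^{(k)}`; the second printed inequality
  `≥ (a_k/(a_k+O(1)))m²Σ|φ|²` «if m² ≤ O(1)» is `ineq44_printed_window` (`m² ≤ M ⇒ a m²/(a+m²) ≥ (a/(a+M))·m²`).
* §3 **`ineq44_region`** — the HYPOTHESIS-FREE INSTANCE on [B4]'s lattice model: the region carrier `fineDom n Ω` of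
  r01's lineage (Neumann weights `regWt`, block weights `rBlkWt`, base corners `rbaseEmb`, staircase contours
  `rstairContour`, `s = n^{−(d+1)}`, links `fieldLink F κ fun u v : ↥(fineDom n Ω) => A u.1 v.1`) for EVERY bond function `A`, orthogonal flow `F`, coupling
  `κ`, `n ≥ 1`, finite `Ω^{(k)} ⊂ ℤ^{d+1}`, `m² ≥ 0`, `a_k > 0` — the `h44` input (`κ = a_k/(a_k+m²)`) of
  `B4Ineq46Lattice.prop31_of_ineq47_ineq44` («γ₀ = ½ min{γ₀′/2d, a_k/(a_k+O(1))}»).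
* §4 **`prop31_region_of_ineq47`** — p. 590 «Now it is easily seen that to prove (1.18) it is sufficient to prove (4.7)
  … Then γ₀ = ½ min{γ₀′/2d, a_k/(a_k+O(1))}» ON THE LATTICE MODEL with nothing assumed but (4.7): if every bond term
  satisfies (4.7) with constants `γ₀′`, `E`, then `⟨φ, Δ^{(k)}(Ω,A)φ⟩ ≥ γ₀(Σ_b D b + m²|φ|²) − (E/2)|φ|²`,
  `γ₀ = ½ min{γ₀′/2(d+1), a_k/(a_k+m²)}` — (4.4) `ineq44_region` + (4.6) `B4Ineq46Lattice.ineq46_printed_region` +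
  `sum_bonds_endSq_le`, every `A`, every `m² ≥ 0`.
HONEST SCOPE.  The Gaussian integral (4.2) itself is not evaluated (p35 certifies the algebra of its exponent: the value
of the integral is `const·exp[−½F(Φ⋆,ψ)]`); the hypotheses of §2 are p35's Jensen hypotheses on `(q, s, N, T)` plus
`c ≥ 0` and the invertibility of `H` (1.6) (holds for every `A` on the model, `b4Op_posDef`).  Theorems only apart from
no definition at all; no `Prop`-valued fact, no `sorry`; axioms standard.
-/

namespace Literature.MathematicalPhysics.QuantumFieldTheory.Balaban1983to89.B4Ineq44MassPart

open Matrix Finset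
open Literature.MathematicalPhysics.QuantumFieldTheory.Balaban1983to89.B4GaugeCovariance
open Literature.MathematicalPhysics.QuantumFieldTheory.Balaban1983to89.B4Lower18Regular
  (dotProduct_self_nonneg' dotProduct_eq_sum_fld PathRel transport_fieldLink)
open Literature.MathematicalPhysics.QuantumFieldTheory.Balaban1983to89.B4Lower18RegularRegion (regWt regWt_nonneg rBlkWt
  rBlkWt_nonneg sum_rBlkWt_row sum_rBlkWt_col rbaseEmb rstairContour rstairContour_end pathRel_mono rstairContour_path)
open Literature.MathematicalPhysics.QuantumFieldTheory.Balaban1983to89.B4Lower18 (fineDom)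
open Literature.MathematicalPhysics.QuantumFieldTheory.Balaban1983to89.B4Prop31Energy
open Literature.MathematicalPhysics.QuantumFieldTheory.Balaban1983to89.B4Ineq45Decoupling (covLap_form_nonneg kinMass_form)
open Literature.MathematicalPhysics.QuantumFieldTheory.Balaban1983to89.B4Eq16GreenExists (b4Op_posDef rBlkWt_cover)
open Literature.MathematicalPhysics.QuantumFieldTheory.Balaban1983to89.B4Ineq46Lattice (bonds bondTerm endSq rblk
  sum_bonds_endSq_le ineq46_printed_region)

noncomputable section

/-! ## §1. The single-block minimum behind (4.3) -/

/-- **THE SINGLE-BLOCK MINIMUM OF (4.2)–(4.3)**: `m²|v|² + a|w − v|² ≥ (am²/(a+m²))|w|²` for vectors `v, w` (`a + m² > 0`),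
with equality at `v = (a/(a+m²))w` — the exponent `½(a_km²/(a_k+m²))|φ(x)|²` of (4.3).
[cite: Balaban1983RegularityDecay, (4.3) p.589] -/
theorem mass_pointwise {ι : Type*} [Fintype ι] {a m2 : ℝ} (ham : 0 < a + m2) (v w : ι → ℝ) :
    a * m2 / (a + m2) * (w ⬝ᵥ w) ≤ m2 * (v ⬝ᵥ v) + a * ((w - v) ⬝ᵥ (w - v)) := by
  rw [div_mul_eq_mul_div, div_le_iff₀ ham]
  -- `(a+m²)(m²|v|² + a|w−v|²) − am²|w|² = |m²v − a(w−v)|² ≥ 0`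
  have h0 := dotProduct_self_nonneg' (m2 • v - a • (w - v))
  have hexp : (m2 • v - a • (w - v)) ⬝ᵥ (m2 • v - a • (w - v))
      = m2 * m2 * (v ⬝ᵥ v) - 2 * (a * m2) * (v ⬝ᵥ (w - v)) + a * a * ((w - v) ⬝ᵥ (w - v)) := by
    simp only [sub_dotProduct, dotProduct_sub, smul_dotProduct, dotProduct_smul, smul_eq_mul, dotProduct_comm (w - v) v]
    ring
  have hw : w ⬝ᵥ w = v ⬝ᵥ v + 2 * (v ⬝ᵥ (w - v)) + (w - v) ⬝ᵥ (w - v) := by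
    have : w = v + (w - v) := by abel
    conv_lhs => rw [this]
    simp only [add_dotProduct, dotProduct_add, dotProduct_comm (w - v) v]
    ring
  rw [hexp] at h0
  rw [hw]
  nlinarith [h0]

/-! ## §2. (4.4) as printed, for every link field -/

section Generic

variable {X Y ι : Type*} [Fintype X] [Fintype Y] [Fintype ι] [DecidableEq X] [DecidableEq Y] [DecidableEq ι]

/-- **(4.4) AS PRINTED — THE MASS PART OF THE LOWER BOUND, FOR EVERY LINK FIELD**: «(the left hand side of (1.18)) ≥
Σ_{x∈Ω^{(k)}} (a_km²/(a_k + m²))|φ(x)|²», i.e. `(a·m²/(a+m²))·|ψ|² ≤ ⟨ψ, Δ^{(k)}(Ω,A)ψ⟩` for the operator (1.14)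
`Δ^{(k)} = a·1 − a²s·Q_kG_kQ_k^*` built from ANY bond weights `c ≥ 0`, block weights `q ≥ 0` with row sums `≤ N`,
`sN ≤ 1`, column sums `≤ 1` (`s·Q` = the block average), ANY link variables `W`, transporters `T` orthogonal on the
support of `q`, `m² ≥ 0`, `a > 0`, `H` (1.6) invertible.  Printed proof: (4.1)–(4.3) (`cenergy_gStar`), the kinetic term
dropped («G_k(Ω,A) ≤ ((a_kP_k(A) + m²)|_Ω)^{−1}»), Jensen on blocks, the single-block minimum `mass_pointwise`.
[cite: Balaban1983RegularityDecay, (4.4) p.589] -/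
theorem ineq44_printed {c : X → X → ℝ} (hc : ∀ x x', 0 ≤ c x x') {m2 a s : ℝ} (hm : 0 ≤ m2) (ha : 0 < a)
    (hs : 0 ≤ s) {q : Y → X → ℝ} (hq : ∀ y x, 0 ≤ q y x) {N : ℝ} (hsN : s * N ≤ 1) (hrow : ∀ y, ∑ x, q y x ≤ N)
    (hcol : ∀ x, ∑ y, q y x ≤ 1) {W : X → X → Matrix ι ι ℝ} {T : Y → X → Matrix ι ι ℝ}
    (hT : ∀ y x, q y x ≠ 0 → (T y x)ᵀ * T y x = 1) (hH : IsUnit (covOp c m2 (a * s) q W T).det) (ψ : Y × ι → ℝ) :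
    a * m2 / (a + m2) * (ψ ⬝ᵥ ψ) ≤ ψ ⬝ᵥ (keff c m2 a s q W T *ᵥ ψ) := by
  rw [← cenergy_gStar hH ψ]
  set Φ := gStar c m2 a s q W T ψ with hΦ
  unfold cenergy
  rw [kinMass_form]
  have hkin := covLap_form_nonneg hc W Φ
  -- Jensen on the blocks: `m² Σ_y |sQΦ(y)|² ≤ s·m²|Φ|²`
  have hJ := sum_avg_sq_le hq hs hsN hrow hcol hT Φ
  -- the residual blockwise
  have hres := resid_sq_eq s q T Φ ψ
  -- the single-block minimum, summed
  have hpt : ∀ y, a * m2 / (a + m2) * (fld ψ y ⬝ᵥ fld ψ y)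
      ≤ m2 * ((s • fld (avgOp q T *ᵥ Φ) y) ⬝ᵥ (s • fld (avgOp q T *ᵥ Φ) y))
        + a * ((fld ψ y - s • fld (avgOp q T *ᵥ Φ) y) ⬝ᵥ (fld ψ y - s • fld (avgOp q T *ᵥ Φ) y)) :=
    fun y => mass_pointwise (add_pos_of_pos_of_nonneg ha hm) _ _
  have hsum := Finset.sum_le_sum fun y (_ : y ∈ (Finset.univ : Finset Y)) => hpt y
  rw [← Finset.mul_sum, ← dotProduct_eq_sum_fld ψ ψ, Finset.sum_add_distrib, ← Finset.mul_sum, ← Finset.mul_sum,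
    ← hres] at hsum
  have hm' : m2 * ∑ y, (s • fld (avgOp q T *ᵥ Φ) y) ⬝ᵥ (s • fld (avgOp q T *ᵥ Φ) y) ≤ m2 * (s * (Φ ⬝ᵥ Φ)) :=
    mul_le_mul_of_nonneg_left hJ hm
  nlinarith [mul_nonneg hs hkin]

/-- **(4.4), SECOND INEQUALITY «≥ (a_k/(a_k + O(1)))·m²Σ_{x∈Ω^{(k)}}|φ(x)|² if m² ≤ O(1)»**: on a mass window `m² ≤ M`
the constant `a m²/(a + m²)` is at least `(a/(a + M))·m²`. [cite: Balaban1983RegularityDecay, (4.4) p.589 «if m² ≤ O(1)»] -/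
theorem ineq44_printed_window {c : X → X → ℝ} (hc : ∀ x x', 0 ≤ c x x') {m2 a s : ℝ} (hm : 0 ≤ m2) (ha : 0 < a)
    (hs : 0 ≤ s) {q : Y → X → ℝ} (hq : ∀ y x, 0 ≤ q y x) {N : ℝ} (hsN : s * N ≤ 1) (hrow : ∀ y, ∑ x, q y x ≤ N)
    (hcol : ∀ x, ∑ y, q y x ≤ 1) {W : X → X → Matrix ι ι ℝ} {T : Y → X → Matrix ι ι ℝ}
    (hT : ∀ y x, q y x ≠ 0 → (T y x)ᵀ * T y x = 1) (hH : IsUnit (covOp c m2 (a * s) q W T).det)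
    {M : ℝ} (hM : m2 ≤ M) (ψ : Y × ι → ℝ) :
    a / (a + M) * (m2 * (ψ ⬝ᵥ ψ)) ≤ ψ ⬝ᵥ (keff c m2 a s q W T *ᵥ ψ) := by
  refine le_trans ?_ (ineq44_printed hc hm ha hs hq hsN hrow hcol hT hH ψ)
  have hN : 0 ≤ ψ ⬝ᵥ ψ := dotProduct_self_nonneg' ψ
  have h1 : 0 < a + m2 := add_pos_of_pos_of_nonneg ha hm
  have h2 : 0 < a + M := lt_of_lt_of_le h1 (by linarith)
  rw [← mul_assoc]
  refine mul_le_mul_of_nonneg_right ?_ hN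
  rw [div_mul_eq_mul_div, div_le_div_iff₀ h2 h1]
  nlinarith [mul_nonneg ha.le hm]

end Generic

/-! ## §3. The hypothesis-free instance on [B4]'s lattice model -/

section Model

variable {d : ℕ} {ι : Type} [Fintype ι] [DecidableEq ι]

/-- **(4.4) ON [B4]'s LATTICE MODEL, HYPOTHESIS-FREE**: on every finite union `Ω = ⋃_{y∈Ω^{(k)}} B^k(y)` of unit blocks
of `ηℤ^{d+1}` (`n = η⁻¹ ≥ 1`), with the Neumann bond weights, block weights, base corners and staircase contours of r01's
region carrier and the block normalisation `s = n^{−(d+1)}`, for EVERY bond function `A`, orthogonal flow `U = F.U`,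
coupling `κ`, `m² ≥ 0`, `a_k > 0` and every `φ`:
`(a_km²/(a_k + m²))·Σ_{x∈Ω^{(k)}}|φ(x)|² ≤ ⟨φ, Δ^{(k)}(Ω,A)φ⟩`. [cite: Balaban1983RegularityDecay, (4.4) p.589] -/
theorem ineq44_region (F : OrthFlow ι) (κ : ℝ) {n : ℕ} (hn : 1 ≤ n) (Ω : Finset (Fin (d + 1) → ℤ)) {m2 a : ℝ}
    (hm : 0 ≤ m2) (ha : 0 < a) (A : (Fin (d + 1) → ℤ) → (Fin (d + 1) → ℤ) → ℝ) (ψ : ↥Ω × ι → ℝ) :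
    a * m2 / (a + m2) * (ψ ⬝ᵥ ψ)
      ≤ ψ ⬝ᵥ (keff (regWt n (fineDom n Ω)) m2 a (((n : ℝ) ^ (d + 1))⁻¹) (rBlkWt n Ω (fineDom n Ω))
          (fieldLink F κ fun u v : ↥(fineDom n Ω) => A u.1 v.1) (contourTrans (fieldLink F κ fun u v : ↥(fineDom n Ω) => A u.1 v.1) (rbaseEmb hn Ω) (rstairContour hn Ω)) *ᵥ ψ) := by
  have hn' : (0 : ℝ) < n := by exact_mod_cast hn
  have hs : (0 : ℝ) ≤ ((n : ℝ) ^ (d + 1))⁻¹ := by positivity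
  have hsN : ((n : ℝ) ^ (d + 1))⁻¹ * (n : ℝ) ^ (d + 1) ≤ 1 := by rw [inv_mul_cancel₀ (by positivity)]
  have hT : ∀ (y : ↥Ω) (x : ↥(fineDom n Ω)), rBlkWt n Ω (fineDom n Ω) y x ≠ 0 →
      (contourTrans (fieldLink F κ fun u v : ↥(fineDom n Ω) => A u.1 v.1) (rbaseEmb hn Ω) (rstairContour hn Ω) y x)ᵀ
        * contourTrans (fieldLink F κ fun u v : ↥(fineDom n Ω) => A u.1 v.1) (rbaseEmb hn Ω) (rstairContour hn Ω) y x = 1 := by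
    intro y x _
    unfold contourTrans
    rw [transport_fieldLink]
    exact F.orth _
  -- (1.6) is positive definite for every `A` (p35), hence invertible
  have hpath : ∀ (y : ↥Ω) (x : ↥(fineDom n Ω)), rBlkWt n Ω (fineDom n Ω) y x ≠ 0 →
      PathRel (fun u v : ↥(fineDom n Ω) => 0 < regWt n (fineDom n Ω) u v) (rbaseEmb hn Ω y) (rstairContour hn Ω y x) := by
    intro y x _
    refine pathRel_mono (fun u v huv => ?_) _ _ (rstairContour_path hn Ω y x)
    simp only [regWt, if_pos huv.1, mul_one]
    positivity
  have hpd := b4Op_posDef F κ (regWt_nonneg n (fineDom n Ω)) hm (mul_pos ha (by positivity : (0 : ℝ) < ((n : ℝ) ^ (d + 1))⁻¹))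
    (rBlkWt_nonneg n Ω (fineDom n Ω)) (rBlkWt_cover hn Ω) hpath (fun y x h => rstairContour_end hn Ω y x h)
    (fun u v : ↥(fineDom n Ω) => A u.1 v.1)
  have hH : IsUnit (covOp (regWt n (fineDom n Ω)) m2 (a * ((n : ℝ) ^ (d + 1))⁻¹) (rBlkWt n Ω (fineDom n Ω))
      (fieldLink F κ fun u v : ↥(fineDom n Ω) => A u.1 v.1) (contourTrans (fieldLink F κ fun u v : ↥(fineDom n Ω) => A u.1 v.1) (rbaseEmb hn Ω) (rstairContour hn Ω))).det :=
    (Matrix.isUnit_iff_isUnit_det _).1 hpd.isUnit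
  exact ineq44_printed (regWt_nonneg n (fineDom n Ω)) hm ha hs (rBlkWt_nonneg n Ω (fineDom n Ω)) hsN
    (sum_rBlkWt_row hn Ω) (sum_rBlkWt_col n Ω (fineDom n Ω)) hT hH ψ

/-! ## §4. «To prove (1.18) it is sufficient to prove (4.7)» on the lattice model -/

/-- **«Now it is easily seen that to prove (1.18) it is sufficient to prove (4.7) with γ₀′ independent of k, ⟨x,x′⟩, and
A. Then γ₀ = ½ min{γ₀′/2d, a_k/(a_k + O(1))}» ON [B4]'s LATTICE MODEL, NOTHING ASSUMED BUT (4.7)**: on the region carrier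
`fineDom n Ω` (every bond function `A`, orthogonal flow, coupling, `n ≥ 1`, finite `Ω^{(k)}`, `m² ≥ 0`, `a_k > 0`), if
every bond term satisfies (4.7), `bondTerm b φ ≥ γ₀′·D(b) − E·(|φ(x)|² + |φ(x′)|²)` (`D(b) ≥ 0` standing for the printed
`|U(A(⟨x,x′⟩))φ(x′) − φ(x)|²`, `E` for `O(1)e²p²(e)`), then
`⟨φ, Δ^{(k)}(Ω,A)φ⟩ ≥ γ₀·(Σ_{⟨x,x′⟩⊂Ω^{(k)}} D(⟨x,x′⟩) + m²Σ_x|φ(x)|²) − (E/2)·Σ_x|φ(x)|²`,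
`γ₀ = ½ min{γ₀′/2(d+1), a_k/(a_k + m²)}` — by (4.6) (`B4Ineq46Lattice.ineq46_printed_region`), a point lying in at most
`2(d+1)` bonds (`sum_bonds_endSq_le`), and (4.4) (`ineq44_region`), averaged.
[cite: Balaban1983RegularityDecay, p.590 «Then γ₀ = ½ min{γ₀′/2d, a_k/(a_k+O(1))}», (4.4) p.589, (4.6)–(4.7) p.590] -/
theorem prop31_region_of_ineq47 (F : OrthFlow ι) (κ : ℝ) {n : ℕ} (hn : 1 ≤ n) (Ω : Finset (Fin (d + 1) → ℤ))
    {m2 a : ℝ} (hm : 0 ≤ m2) (ha : 0 < a) (A : (Fin (d + 1) → ℤ) → (Fin (d + 1) → ℤ) → ℝ) (ψ : ↥Ω × ι → ℝ)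
    (D : ↥Ω × Fin (d + 1) → ℝ) (hD : ∀ b ∈ bonds Ω, 0 ≤ D b) {γ' E : ℝ} (hE : 0 ≤ E)
    (h47 : ∀ b ∈ bonds Ω, γ' * D b - E * endSq Ω ψ b ≤
      bondTerm Ω (rblk hn Ω) (regWt n (fineDom n Ω)) m2 a (((n : ℝ) ^ (d + 1))⁻¹) (rBlkWt n Ω (fineDom n Ω))
        (fieldLink F κ fun u v : ↥(fineDom n Ω) => A u.1 v.1) (contourTrans (fieldLink F κ fun u v : ↥(fineDom n Ω) => A u.1 v.1) (rbaseEmb hn Ω) (rstairContour hn Ω)) b ψ) :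
    (min (γ' / (2 * ((d : ℝ) + 1))) (a / (a + m2))) / 2 * (∑ b ∈ bonds Ω, D b + m2 * (ψ ⬝ᵥ ψ)) - E / 2 * (ψ ⬝ᵥ ψ)
      ≤ ψ ⬝ᵥ (keff (regWt n (fineDom n Ω)) m2 a (((n : ℝ) ^ (d + 1))⁻¹) (rBlkWt n Ω (fineDom n Ω))
          (fieldLink F κ fun u v : ↥(fineDom n Ω) => A u.1 v.1) (contourTrans (fieldLink F κ fun u v : ↥(fineDom n Ω) => A u.1 v.1) (rbaseEmb hn Ω) (rstairContour hn Ω)) *ᵥ ψ) := by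
  have hn' : (0 : ℝ) < n := by exact_mod_cast hn
  have hs : (0 : ℝ) < ((n : ℝ) ^ (d + 1))⁻¹ := by positivity
  -- (4.6) on the model and (4.4) on the model
  have h46 := ineq46_printed_region F κ hn Ω hm ha hs A ψ
  have h44 := ineq44_region F κ hn Ω hm ha A ψ
  set R := ψ ⬝ᵥ (keff (regWt n (fineDom n Ω)) m2 a (((n : ℝ) ^ (d + 1))⁻¹) (rBlkWt n Ω (fineDom n Ω))
    (fieldLink F κ fun u v : ↥(fineDom n Ω) => A u.1 v.1) (contourTrans (fieldLink F κ fun u v : ↥(fineDom n Ω) => A u.1 v.1) (rbaseEmb hn Ω) (rstairContour hn Ω)) *ᵥ ψ) with hR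
  set S := ∑ b ∈ bonds Ω, D b with hSdef
  set N := ψ ⬝ᵥ ψ with hNdef
  set B := ∑ b ∈ bonds Ω, bondTerm Ω (rblk hn Ω) (regWt n (fineDom n Ω)) m2 a (((n : ℝ) ^ (d + 1))⁻¹)
    (rBlkWt n Ω (fineDom n Ω)) (fieldLink F κ fun u v : ↥(fineDom n Ω) => A u.1 v.1)
    (contourTrans (fieldLink F κ fun u v : ↥(fineDom n Ω) => A u.1 v.1) (rbaseEmb hn Ω) (rstairContour hn Ω)) b ψ with hBdef
  have hS : 0 ≤ S := Finset.sum_nonneg hD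
  have hN : 0 ≤ N := dotProduct_self_nonneg' ψ
  -- sum (4.7) over the bonds
  have hsum : γ' * S - E * ∑ b ∈ bonds Ω, endSq Ω ψ b ≤ B := by
    rw [hSdef, Finset.mul_sum, Finset.mul_sum, ← Finset.sum_sub_distrib]
    exact Finset.sum_le_sum h47
  have hend := sum_bonds_endSq_le Ω ψ
  have hpos : (0 : ℝ) < 2 * ((d : ℝ) + 1) := by positivity
  have hE' : E * ∑ b ∈ bonds Ω, endSq Ω ψ b ≤ E * (2 * ((d : ℝ) + 1) * N) := mul_le_mul_of_nonneg_left hend hE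
  have h2 : γ' * S - E * (2 * ((d : ℝ) + 1) * N) ≤ B := by linarith
  -- divide by `2(d+1)` and use (4.6): `(2(d+1))⁻¹ B ≤ R`
  have h3 : γ' / (2 * ((d : ℝ) + 1)) * S - E * N ≤ R := by
    have h3' := mul_le_mul_of_nonneg_left h2 (le_of_lt (inv_pos.2 hpos))
    have hcan : (2 * ((d : ℝ) + 1))⁻¹ * (2 * ((d : ℝ) + 1)) = 1 := inv_mul_cancel₀ hpos.ne'
    have h4 : (2 * ((d : ℝ) + 1))⁻¹ * (γ' * S - E * (2 * ((d : ℝ) + 1) * N))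
        = γ' / (2 * ((d : ℝ) + 1)) * S - E * N := by
      rw [div_eq_mul_inv]
      linear_combination (-(E * N)) * hcan
    rw [h4] at h3'
    exact h3'.trans h46
  -- (4.4): `(a/(a+m²))·m²N ≤ R`
  have h44' : a / (a + m2) * (m2 * N) ≤ R := by
    have : a / (a + m2) * (m2 * N) = a * m2 / (a + m2) * N := by ring
    rw [this]; exact h44
  -- average the two bounds
  set γ₀' := γ' / (2 * ((d : ℝ) + 1))
  have hmN : 0 ≤ m2 * N := mul_nonneg hm hN
  have hminS : min γ₀' (a / (a + m2)) * S ≤ γ₀' * S := mul_le_mul_of_nonneg_right (min_le_left _ _) hS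
  have hminM : min γ₀' (a / (a + m2)) * (m2 * N) ≤ a / (a + m2) * (m2 * N) :=
    mul_le_mul_of_nonneg_right (min_le_right _ _) hmN
  nlinarith [h3, h44', hminS, hminM]

end Model

end

end Literature.MathematicalPhysics.QuantumFieldTheory.Balaban1983to89.B4Ineq44MassPart
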